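import Literature.Probability.Process.LocallyMatches
import Mathlib.Topology.MetricSpace.Pseudo.Lemmas
import Mathlib.Topology.Sequences
import HarnessLib

/-!
# The local rubber metric on rooted point configurations

Topic: `Literature/Probability/Process`. Part (2) of definition request `defn-LocallyMatches`:
the LOCAL (RUBBER) TOPOLOGY on point configurations of a normed group `E`, generated by the
two-way local matchings `LocallyMatches R ε` (`LocallyMatches.lean`).

Baake–Lenz [BaakeLenz2004, §4 Def. 3–4] topologise the closed subsets of a σ-compact LCA group
by the uniformity with basic entourages
`U_{K,V} = {(P₁, P₂) | P₁ ∩ K ⊆ P₂ + V ∧ P₂ ∩ K ⊆ P₁ + V}` (`K` compact, `V` a neighbourhood of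
`0`) — the *local rubber topology* (LRT); for `K = B̄(0, R)`, `V = B̄(0, ε)` the entourage is
exactly `{(S, T) | LocallyMatches R ε T S}`. Lenz–Stollmann [LenzStollmann2002, §1] define the
same ("natural") topology on the closed subsets of `ℝᵈ` through the cut-off distances `d_k` and
observe that the `d_k` violate the triangle inequality (a point may sit just inside the cut-off
ball for one set and just outside for the other). Coupling the cut-off radius to the tolerance
repairs this — "the standard way" of aperiodic order (Lee–Moody–Solomyak [LeeMoodySolomyak2002,
§2] use `min{d̃, 2^{-1/2}}`, `d̃ = inf {ε | agreement on B_{1/ε}(0) up to an ε-translation}` for FLC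
sets; the rubber version displaces points individually): we put

* `matchScales S T = {ε > 0 | LocallyMatches ε⁻¹ ε S T}` (an upper set of scales) and
* `rubberDist S T = inf ({1} ∪ matchScales S T) ∈ [0, 1]`,

and PROVE that `rubberDist` is a pseudometric (`rubberDist_triangle`: if `a + b < 1` then
`a (a + b) ≤ 1`, which is precisely the radius loss `(a+b)⁻¹ + b ≤ a⁻¹` allowed by
`LocallyMatches.trans` — the computation `1/ε₁ - ε₂ ≥ 1/(ε₁ + ε₂)` of Lee–Moody–Solomyak). The
type synonym

* `LocalConfig E` (a structure wrapping `carrier : Set E`, `SetLike`)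

carries the resulting `PseudoMetricSpace` instance, and the metric uniformity / topology IS the
local rubber uniformity: `uniformity_hasBasis_locallyMatches`, `nhds_hasBasis_locallyMatches`,
`tendsto_iff_locallyMatches` (convergence = eventual `(R, ε)`-matching for all `R`, `ε > 0`).

## API (all proved)
* `rubberDist_nonneg`, `rubberDist_le_one`, `rubberDist_le_of_locallyMatches`,
  `locallyMatches_of_rubberDist_lt`, `rubberDist_comm`, `rubberDist_self`, `rubberDist_triangle`;
* `LocalConfig.dist_def`, the three `HasBasis` statements above, `tendsto_iff_locallyMatches`,
  `exists_dist_lt_locallyMatches` (a uniform `η(R, ε)`);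
Sequel `LocalRubberHardCore.lean`: open matching events (fattenings pass along local limits),
the rooted `δ`-hard-core configurations form a closed set (Baake–Lenz Prop. 4) and are the
preimage of `IsRootedHardCore δ` under `S ↦ count|S`.

## Design notes
* The cap `1` makes `rubberDist` a bounded (pseudo)metric; any cap `≤ 1` gives the same uniformity.
  `rubberDist S T = 0` iff `S` and `T` match at every scale (e.g. `S` and its closure): on closed
  sets it is a metric (Baake–Lenz Thm 3: the LRT is Hausdorff); we do not quotient.
* Scales are `ε⁻¹` (not `1/ε`) to match Mathlib's `inv` lemmas.
* NOT here — sequels: COMPACTNESS of `LocalConfig E` for proper `E` (Baake–Lenz Thm 3 /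
  Lenz–Stollmann Thm 1.2) in `LocalRubberCompact.lean`; the compact metric space of rooted
  hard-core configurations and the measurability of `S ↦ count|S` in `RootedHardCoreConfig.lean`;
  the identification with vague convergence of counting measures (Baake–Lenz Thm 4) in
  `RootedHardCoreVague.lean`. Not formalised: the Fell topology (Baake–Lenz App.) and the
  closedness of `IsPointStationaryLaw` under weak limits for this topology.

## References
* M. Baake, D. Lenz, *Dynamical systems on translation bounded measures: pure point dynamical and
  diffraction spectra*, Ergodic Theory Dynam. Systems 24 (2004) 1867–1893, §4 Def. 3–4, Thm 3,
  Prop. 4, Thm 4. [BaakeLenz2004]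
* D. Lenz, P. Stollmann, *Delone dynamical systems and associated random operators*, Proc. OAMP
  Constanța 2001 (Theta 2003), arXiv:math-ph/0202042, §1 (d_k, natural topology, Thm 1.2).
  [LenzStollmann2002]
* J.-Y. Lee, R. V. Moody, B. Solomyak, *Pure point dynamical and diffraction spectra*, Ann. Henri
  Poincaré 3 (2002) 1003–1018, §2 (the metric `min{d̃, 2^{-1/2}}` and its triangle inequality).
  [LeeMoodySolomyak2002]
* M. Baake, U. Grimm, *Aperiodic Order* I, CUP 2013, §5.4 Remark 5.6. [BaakeGrimm2013]
-/

noncomputable section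

open _root_.MeasureTheory Set Filter
open scoped _root_.Topology Uniformity

namespace Literature.Probability.Process

/-! ### The rubber distance on point sets -/

section RubberDist

variable {E : Type*} [SeminormedAddCommGroup E]

/-- The **matching scales** of two configurations: the `ε > 0` at which `S` and `T` are two-way
matched on the central ball of radius `ε⁻¹` with tolerance `ε` ("`ε`-close in the local rubber
topology", [cite: BaakeGrimm2013, §5.4 Remark 5.6]). An upper set (`mem_matchScales_of_le`). -/
def matchScales (S T : Set E) : Set ℝ :=
  {ε | 0 < ε ∧ LocallyMatches ε⁻¹ ε S T}

variable {S T U : Set E} {ε ε' η : ℝ}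

/-- Unfolding `matchScales`. [folklore] -/
theorem mem_matchScales_iff : ε ∈ matchScales S T ↔ 0 < ε ∧ LocallyMatches ε⁻¹ ε S T :=
  Iff.rfl

/-- `matchScales S T` is an upper set: a matching at scale `ε` is one at every `ε' ≥ ε` (smaller
ball, larger tolerance). [folklore] -/
theorem mem_matchScales_of_le (h : ε ∈ matchScales S T) (hle : ε ≤ ε') : ε' ∈ matchScales S T :=
  ⟨h.1.trans_le hle, h.2.mono (inv_anti₀ h.1 hle) hle⟩

/-- `matchScales` is symmetric. [folklore] -/
theorem matchScales_comm (S T : Set E) : matchScales S T = matchScales T S := by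
  ext ε
  exact and_congr_right fun _ => locallyMatches_comm

/-- Every positive scale matches a configuration with itself. [folklore] -/
theorem mem_matchScales_self (hε : 0 < ε) (S : Set E) : ε ∈ matchScales S S :=
  ⟨hε, locallyMatches_self hε.le S _⟩

/-- The **local rubber distance** of two configurations: the infimum of their matching scales,
capped at `1` — a bounded pseudometric (`rubberDist_triangle`), the point-wise displacement
("rubber") variant of the standard metric `min{d̃, 2^{-1/2}}` of aperiodic order
(Lee–Moody–Solomyak 2002, §2); it generates the local rubber uniformity of Baake–Lenz 2004, §4
Def. 4 (proved: `LocalConfig.uniformity_hasBasis_locallyMatches`). [folklore] -/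
def rubberDist (S T : Set E) : ℝ :=
  sInf (insert 1 (matchScales S T))

/-- The scale set `{1} ∪ matchScales S T` is bounded below by `0`. [folklore] -/
theorem rubber_bddBelow (S T : Set E) : BddBelow (insert 1 (matchScales S T)) :=
  ⟨0, by
    rintro x (rfl | hx)
    · norm_num
    · exact hx.1.le⟩

/-- The scale set `{1} ∪ matchScales S T` is nonempty (it contains the cap `1`). [folklore] -/
theorem rubber_nonempty (S T : Set E) : (insert 1 (matchScales S T)).Nonempty :=
  ⟨1, mem_insert _ _⟩

/-- `0 ≤ rubberDist S T`. [folklore] -/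
theorem rubberDist_nonneg : 0 ≤ rubberDist S T :=
  le_csInf (rubber_nonempty S T) (by
    rintro x (rfl | hx)
    · norm_num
    · exact hx.1.le)

/-- `rubberDist S T ≤ 1` (the cap). [folklore] -/
theorem rubberDist_le_one : rubberDist S T ≤ 1 :=
  csInf_le (rubber_bddBelow S T) (mem_insert _ _)

/-- A matching at scale `ε` bounds the rubber distance by `ε`. [folklore] -/
theorem rubberDist_le_of_locallyMatches (hε : 0 < ε) (h : LocallyMatches ε⁻¹ ε S T) :
    rubberDist S T ≤ ε :=
  csInf_le (rubber_bddBelow S T) (mem_insert_of_mem _ ⟨hε, h⟩)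

/-- If `rubberDist S T < η ≤ 1` then `S` and `T` match at some scale `ε < η`. [folklore] -/
theorem exists_locallyMatches_of_rubberDist_lt (h : rubberDist S T < η) (hη : η ≤ 1) :
    ∃ ε, 0 < ε ∧ ε < η ∧ LocallyMatches ε⁻¹ ε S T := by
  obtain ⟨a, ha, haη⟩ := exists_lt_of_csInf_lt (rubber_nonempty S T) h
  rcases ha with rfl | ha
  · exact absurd hη (not_le.2 haη)
  · exact ⟨a, ha.1, haη, ha.2⟩

/-- If `rubberDist S T < η ≤ 1` then `S` and `T` are `(η⁻¹, η)`-matched. (The cap matters: the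
empty configuration and `{0}` are at distance `1` and match at no scale.) [folklore] -/
theorem locallyMatches_of_rubberDist_lt (h : rubberDist S T < η) (hη : η ≤ 1) :
    LocallyMatches η⁻¹ η S T := by
  obtain ⟨ε, hε, hεη, hm⟩ := exists_locallyMatches_of_rubberDist_lt h hη
  exact (mem_matchScales_of_le ⟨hε, hm⟩ hεη.le).2

/-- The rubber distance is symmetric. [folklore] -/
theorem rubberDist_comm (S T : Set E) : rubberDist S T = rubberDist T S := by
  rw [rubberDist, rubberDist, matchScales_comm]

/-- The rubber distance of a configuration to itself vanishes. [folklore] -/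
theorem rubberDist_self (S : Set E) : rubberDist S S = 0 := by
  refine le_antisymm (le_of_forall_pos_lt_add fun η hη => ?_) rubberDist_nonneg
  have h : rubberDist S S ≤ min (η / 2) 1 :=
    rubberDist_le_of_locallyMatches (lt_min (by linarith) one_pos)
      (mem_matchScales_self (lt_min (by linarith) one_pos) S).2
  have h2 : min (η / 2) 1 ≤ η / 2 := min_le_left _ _
  linarith

/-- **Triangle inequality for the rubber distance.** If `rubberDist S T < a`, `rubberDist T U < b`
with `a + b ≤ 1`, the `(a⁻¹, a)`- and `(b⁻¹, b)`-matchings compose (`LocallyMatches.trans`) to an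
`((a+b)⁻¹, a+b)`-matching because `(a+b)⁻¹ + b ≤ a⁻¹` and `(a+b)⁻¹ + a ≤ b⁻¹`, i.e.
`a (a + b) ≤ 1` and `b (a + b) ≤ 1`; if `a + b ≥ 1` the cap concludes (the computation
`1/ε₁ - ε₂ ≥ 1/(ε₁ + ε₂)` of [cite: LeeMoodySolomyak2002, §2]). -/
theorem rubberDist_triangle (S T U : Set E) :
    rubberDist S U ≤ rubberDist S T + rubberDist T U := by
  by_cases hsum : 1 ≤ rubberDist S T + rubberDist T U
  · exact rubberDist_le_one.trans hsum
  push Not at hsum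
  refine le_of_forall_pos_lt_add fun η hη => ?_
  have h0ST : 0 ≤ rubberDist S T := rubberDist_nonneg
  have h0TU : 0 ≤ rubberDist T U := rubberDist_nonneg
  -- a common slack `θ > 0` with `2θ < η` and `d(S,T) + d(T,U) + 2θ < 1`
  obtain ⟨θ, hθ, hθη, hθ1⟩ : ∃ θ : ℝ, 0 < θ ∧ 2 * θ < η ∧
      rubberDist S T + rubberDist T U + 2 * θ < 1 := by
    refine ⟨min (η / 4) ((1 - (rubberDist S T + rubberDist T U)) / 4), ?_, ?_, ?_⟩
    · exact lt_min (by linarith) (by linarith)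
    · have := min_le_left (η / 4) ((1 - (rubberDist S T + rubberDist T U)) / 4)
      linarith
    · have := min_le_right (η / 4) ((1 - (rubberDist S T + rubberDist T U)) / 4)
      linarith
  set a := rubberDist S T + θ with ha_def
  set b := rubberDist T U + θ with hb_def
  have ha0 : 0 < a := by rw [ha_def]; linarith
  have hb0 : 0 < b := by rw [hb_def]; linarith
  have hab : 0 < a + b := by linarith
  have hab1 : a + b < 1 := by rw [ha_def, hb_def]; linarith
  have ha : LocallyMatches a⁻¹ a S T :=
    locallyMatches_of_rubberDist_lt (by rw [ha_def]; linarith) (by linarith)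
  have hb : LocallyMatches b⁻¹ b T U :=
    locallyMatches_of_rubberDist_lt (by rw [hb_def]; linarith) (by linarith)
  have ha' : a ≠ 0 := ha0.ne'
  have hb' : b ≠ 0 := hb0.ne'
  have hab' : a + b ≠ 0 := hab.ne'
  have h1 : (a + b)⁻¹ + b ≤ a⁻¹ := by
    rw [← sub_nonneg]
    have : a⁻¹ - ((a + b)⁻¹ + b) = b * (1 - a * (a + b)) / (a * (a + b)) := by
      field_simp
      ring
    rw [this]
    apply div_nonneg
    · apply mul_nonneg hb0.le
      nlinarith
    · positivity
  have h2 : (a + b)⁻¹ + a ≤ b⁻¹ := by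
    rw [← sub_nonneg]
    have : b⁻¹ - ((a + b)⁻¹ + a) = a * (1 - b * (a + b)) / (b * (a + b)) := by
      field_simp
      ring
    rw [this]
    apply div_nonneg
    · apply mul_nonneg ha0.le
      nlinarith
    · positivity
  have hm : LocallyMatches (a + b)⁻¹ (a + b) S U := ha.trans hb ha0.le hb0.le h1 h2
  have := rubberDist_le_of_locallyMatches hab hm
  rw [ha_def, hb_def] at this
  linarith

end RubberDist

/-! ### Configurations with the local rubber metric -/

/-- A **point configuration** of `E` — a bare wrapper around a point set `carrier : Set E` — to
carry the local rubber (pseudo)metric `rubberDist` and with it the local rubber topology of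
Baake–Lenz (instance `LocalConfig.instPseudoMetricSpace`). [cite: BaakeLenz2004, §4 Def. 4] -/
structure LocalConfig (E : Type*) where
  /-- The underlying point set. -/
  carrier : Set E

namespace LocalConfig

section Basic

variable {E : Type*}

/-- A configuration "is" its point set. [folklore] -/
instance instSetLike : SetLike (LocalConfig E) E where
  coe := LocalConfig.carrier
  coe_injective S T h := by
    cases S
    cases T
    congr

/-- Membership in a configuration is membership in its carrier. [folklore] -/
@[simp] theorem mem_mk {S : Set E} {x : E} : x ∈ (LocalConfig.mk S) ↔ x ∈ S := Iff.rfl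

/-- The coercion of `⟨S⟩` to a set is `S`. [folklore] -/
@[simp] theorem coe_mk (S : Set E) : ((LocalConfig.mk S : LocalConfig E) : Set E) = S := rfl

/-- The coercion to a set is the carrier. [folklore] -/
@[simp] theorem coe_eq_carrier (S : LocalConfig E) : (S : Set E) = S.carrier := rfl

/-- Configurations with the same points are equal. [folklore] -/
@[ext] theorem ext {S T : LocalConfig E} (h : ∀ x, x ∈ S ↔ x ∈ T) : S = T := SetLike.ext h

/-- Re-wrapping the carrier gives the configuration back. [folklore] -/
@[simp] theorem mk_coe (S : LocalConfig E) : LocalConfig.mk (S : Set E) = S := by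
  cases S
  rfl

end Basic

section Metric

variable {E : Type*} [SeminormedAddCommGroup E]

/-- **The local rubber metric space of configurations**: `dist S T = rubberDist S T`.
[cite: BaakeLenz2004, §4 Def. 4 and Thm 3] -/
instance instPseudoMetricSpace : PseudoMetricSpace (LocalConfig E) where
  dist S T := rubberDist (S : Set E) T
  dist_self S := rubberDist_self _
  dist_comm S T := rubberDist_comm _ _
  dist_triangle S T U := rubberDist_triangle _ _ _

/-- Unfolding the distance of `LocalConfig E`. [folklore] -/
theorem dist_def (S T : LocalConfig E) : dist S T = rubberDist (S : Set E) T := rfl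

/-- `dist S T ≤ 1`. [folklore] -/
theorem dist_le_one (S T : LocalConfig E) : dist S T ≤ 1 := rubberDist_le_one

variable {R R' ε ε' : ℝ}

/-- A matching at scale `ε` bounds the distance. [folklore] -/
theorem dist_le_of_locallyMatches {S T : LocalConfig E} (hε : 0 < ε)
    (h : LocallyMatches ε⁻¹ ε (S : Set E) T) : dist S T ≤ ε :=
  rubberDist_le_of_locallyMatches hε h

/-- `dist S T < η ≤ 1` gives an `(η⁻¹, η)`-matching. [folklore] -/
theorem locallyMatches_of_dist_lt {S T : LocalConfig E} {η : ℝ} (h : dist S T < η) (hη : η ≤ 1) :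
    LocallyMatches η⁻¹ η (S : Set E) T :=
  locallyMatches_of_rubberDist_lt h hη

/-- **Uniform comparison, matchings from balls**: for every radius `R` and tolerance `ε > 0` there
is `η > 0` such that `dist S T < η` forces an `(R, ε)`-matching. [folklore] -/
theorem exists_dist_lt_locallyMatches (R : ℝ) (hε : 0 < ε) :
    ∃ η, 0 < η ∧ ∀ S T : LocalConfig E, dist S T < η → LocallyMatches R ε (S : Set E) T := by
  refine ⟨min ε (min 1 (max R 1)⁻¹), lt_min hε (lt_min one_pos (inv_pos.2 (by positivity))),
    fun S T h => ?_⟩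
  have hη1 : min ε (min 1 (max R 1)⁻¹) ≤ 1 := (min_le_right _ _).trans (min_le_left _ _)
  have hm := locallyMatches_of_dist_lt h hη1
  refine hm.mono ?_ (min_le_left _ _)
  have hpos : 0 < min ε (min 1 (max R 1)⁻¹) :=
    lt_min hε (lt_min one_pos (inv_pos.2 (by positivity)))
  calc R ≤ max R 1 := le_max_left _ _
    _ = ((max R 1)⁻¹)⁻¹ := (inv_inv _).symm
    _ ≤ (min ε (min 1 (max R 1)⁻¹))⁻¹ :=
        inv_anti₀ hpos ((min_le_right _ _).trans (min_le_right _ _))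

/-- **Uniform comparison, balls from matchings**: for every `η > 0` there are `R` and `ε > 0` such
that an `(R, ε)`-matching forces `dist S T < η`. [folklore] -/
theorem exists_locallyMatches_dist_lt {η : ℝ} (hη : 0 < η) :
    ∃ R ε, 0 < ε ∧ ∀ S T : LocalConfig E, LocallyMatches R ε (S : Set E) T → dist S T < η := by
  refine ⟨(min (η / 2) 1)⁻¹, min (η / 2) 1, lt_min (by linarith) one_pos, fun S T h => ?_⟩
  have := dist_le_of_locallyMatches (lt_min (by linarith) one_pos) h
  have h2 : min (η / 2) 1 ≤ η / 2 := min_le_left _ _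
  linarith

/-- **The metric uniformity is the local rubber uniformity of Baake–Lenz**: the entourages
`{(S, T) | LocallyMatches R ε S T}`, `ε > 0`, form a basis of `𝓤 (LocalConfig E)`.
[cite: BaakeLenz2004, §4 Def. 4] -/
theorem uniformity_hasBasis_locallyMatches :
    (𝓤 (LocalConfig E)).HasBasis (fun p : ℝ × ℝ => 0 < p.2)
      fun p => {x : LocalConfig E × LocalConfig E | LocallyMatches p.1 p.2 (x.1 : Set E) x.2} := by
  refine Metric.uniformity_basis_dist.to_hasBasis' ?_ ?_
  · intro η hη
    obtain ⟨R, ε, hε, h⟩ := exists_locallyMatches_dist_lt (E := E) hη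
    exact ⟨(R, ε), hε, fun x hx => h x.1 x.2 hx⟩
  · rintro ⟨R, ε⟩ hε
    obtain ⟨η, hη, h⟩ := exists_dist_lt_locallyMatches (E := E) R hε
    exact mem_of_superset (Metric.dist_mem_uniformity hη) fun x hx => h x.1 x.2 hx

/-- The matching neighbourhoods `{T | LocallyMatches R ε S T}`, `ε > 0`, form a basis of `𝓝 S`.
[cite: BaakeLenz2004, §4 Def. 4] -/
theorem nhds_hasBasis_locallyMatches (S : LocalConfig E) :
    (𝓝 S).HasBasis (fun p : ℝ × ℝ => 0 < p.2)
      fun p => {T : LocalConfig E | LocallyMatches p.1 p.2 (S : Set E) T} := by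
  refine Metric.nhds_basis_ball.to_hasBasis' ?_ ?_
  · intro η hη
    obtain ⟨R, ε, hε, h⟩ := exists_locallyMatches_dist_lt (E := E) hη
    refine ⟨(R, ε), hε, fun T hT => ?_⟩
    rw [Metric.mem_ball, dist_comm]
    exact h S T hT
  · rintro ⟨R, ε⟩ hε
    obtain ⟨η, hη, h⟩ := exists_dist_lt_locallyMatches (E := E) R hε
    refine Metric.mem_nhds_iff.2 ⟨η, hη, fun T hT => ?_⟩
    rw [Metric.mem_ball, dist_comm] at hT
    exact h S T hT

/-- **Convergence in the local rubber topology is eventual matching at every scale**: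
`u → S` iff for all `R` and `ε > 0`, eventually `S` and `u n` are `(R, ε)`-matched.
[cite: BaakeLenz2004, §4 Def. 4] -/
theorem tendsto_iff_locallyMatches {ι : Type*} {u : ι → LocalConfig E} {l : Filter ι}
    {S : LocalConfig E} :
    Tendsto u l (𝓝 S) ↔ ∀ R ε : ℝ, 0 < ε → ∀ᶠ n in l, LocallyMatches R ε (S : Set E) (u n) := by
  rw [(nhds_hasBasis_locallyMatches S).tendsto_right_iff]
  simp only [Prod.forall, mem_setOf_eq]

end Metric

end LocalConfig

end Literature.Probability.Process
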